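import Summits.QuantumFields.YangMills.Theorems.BalabanUVNodesN15CurvedGluingLocalGaugesTwoGrid
import HarnessLib

/-!
# Route «BalabanUVNodes» (cluster K4 «SpineRates»), Track-A DAG node N15 = NE2, BACKGROUND LAYER — GLUING ACROSS PER-CUBE GAUGES, TWO GRIDS WITH UNRELATED FINE ∕ COARSE GAUGES:
# file 32's η-defect of the glued operator when cube `k` carries a fine gauge `W′_k` on `X′` and a coarse gauge `W_k` on `X` that agree only up to a DISPLAYED max-row-sum fit `o_W` along `π`
# (g4 `hasMaj_idef_gaugeConj`: three-factor Leibniz, cost `|κ|²` on the defects plus `2|κ|o_W` times the rows)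

Cell `pub-ymgap`, seat `pub-ymgap-dag-n15-w2` (WIDTH SEAT 2∕3 on node N15, director-ym №197 ∕ HUMAN RULING D-0149), g5, tenth piece (bus CLAIM-10) — removes the «pulled-back fine gauge»
restriction of this seat's `…CurvedGluingLocalGaugesTwoGrid` (FILE 8).  CREDIT: the statement and its letters (`(m, r, r_E) ↦ (|κ|²m + 2|κ|o_Wβ, |κ|²r + 2|κ|o_Wθ₀, |κ|²r_E + 2|κ|o_Wε)`)
were announced independently and first in final form by seat `pub-ymgap-dag-n15-w3` g5 (bus COORD-1∕2, its draft `…LocalGaugePairsTwoGrid`, withdrawn in this seat's favour, COORD-3);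
this file is the agreed single filing of that content.  `bears_on: R4∕N15 · K3⁸ SpineGivenEndpointR13SepCoPHV (stmt-QuantumFields-27366)`.  Filed
`--kind proof --supports stmt-QuantumFields-27366 --as helper` — COUNT-NEUTRAL.  Theorems only; 0 `def`, 0 `sorry`.  Imports BY NAME FILE 8 (through it FILE 7 `localOp_conj_back` ∕
`cutRow_of_localGauge` ∕ `commRow_of_localGauge` ∕ `defectRow_of_localGauge`, g4 `…DressedGeneralGauge`: `mulOp_comp_gaugeConj`, `commOp_comp_gaugeConj`, `transpose_gaugeConj_cancel`,
`hasMaj_idef_gaugeConj`, `entry_le_one_of_orthogonal`, `transpose_entry_le_one_of_orthogonal`, n15-w3 file 32 `hasMaj_idef_glued_of_cutRows_defect`); nothing in the tree is modified.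

WHY.  Two grids `π : X′ → X`; cube `k` is computed on the fine grid in a gauge `W′_k` and on the coarse grid in a gauge `W_k` (two axial gauges of the same cube, say), orthogonal, with the
max-row-sum fits `Σ_j|W′_k(x′)ᵀ_{ij} − W_k(πx′)ᵀ_{ij}| ≤ o_W`, `Σ_j|W′_k(x′)_{ij} − W_k(πx′)_{ij}| ≤ o_W` (for `U(N)` gauges: g4 `uN_rowFit_siteGauge(_transpose)` from `‖u′ − u∘π‖_F`).  Then the
η-defects of the conjugated-back pairs pick up, besides `|κ|²`·(local defect), the gauge-mismatch term `2|κ|·o_W`·(local row):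
* §1 ★ `cutDefect_of_localGauges` (`≤ 1_S1_S·(|κ|²m + 2|κ|o_Wβ)e^{−δd}`), ★★ `commDefect_of_localGauges` (`≤ 1_S(y′)·(|κ|²r + 2|κ|o_Wθ₀)e^{−δd}`), ★ `defectDefect_of_localGauges`
  (`≤ 1_S(y)·(|κ|²r_E + 2|κ|o_Wε)e^{−δd}`);
* §2 ★★★ `hasMaj_idef_glued_of_localGauges_fit` — file 32's `𝔇(𝒢′, 𝒢)` majorant for the conjugated-back families with `(β, θ₀, ε) ↦ |κ|²(β, θ₀, ε)`,
  `(m, r, r_E) ↦ (|κ|²m + 2|κ|o_Wβ, |κ|²r + 2|κ|o_Wθ₀, |κ|²r_E + 2|κ|o_Wε)`.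

HONEST FRAMING ∕ LIMITS.  Bookkeeping over DISPLAYED per-cube rows, defects and gauge fits ((3.34)–(3.35) p. 396, (3.42) p. 397, (3.87) p. 409, Thm 3.14 pp. 426–427 = SHAPES ∕ TEMPLATE); the gauges
and their fit, the local parametrices, rows and defects are HYPOTHESES; constants crude.  Nothing of [B5]∕[B6]∕[B9] asserted; NE2⁺ NOT PRINTED, NOT proved; N15 NOT discharged; K3⁸ OPEN,
skeleton v6 untouched; counts of record UNMOVED (typed 28∕28 · discharged 5∕27 · A 5∕28); one finite 𝕋⁴ at fixed ε — NOT ℝ⁴ ∕ OS ∕ mass gap ∕ Clay; R4 closes the conditional finite-𝕋⁴ rung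
`BalabanLadder.UV` only.  Restate-immune (no Theses import).
-/

set_option autoImplicit false

noncomputable section
open scoped BigOperators Matrix
open Finset

namespace Summit.QuantumFields.YangMills.BalabanUVNodes.N15.CurvedSpecies

open Literature.MathematicalPhysics.QuantumFieldTheory.Balaban1983to89
open Literature.MathematicalPhysics.QuantumFieldTheory.Balaban1983to89.B11SectG (BlockNorm HasMaj RowSum)
open Literature.MathematicalPhysics.QuantumFieldTheory.Balaban1983to89.B6RandomWalk (Triangle254)
open Literature.MathematicalPhysics.QuantumFieldTheory.Balaban1983to89.B6Prop26Gluing (mulOp ind ind_nonneg)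
open Literature.MathematicalPhysics.QuantumFieldTheory.Balaban1983to89.T4EtaRateDefect (idef)
open Literature.MathematicalPhysics.QuantumFieldTheory.Balaban1983to89.T4EtaRateCoeffDefect (pull)
open Summit.QuantumFields.YangMills.BalabanUVNodes.N15.MatrixSpecies (mmulOp liftBlk liftMap)
open Summit.QuantumFields.YangMills.BalabanUVNodes.N15.Gluing (parametrix remainder commOp glueInv)

variable {X X' : Type} [Fintype X] [Fintype X'] [DecidableEq X] [DecidableEq X'] {κ : Type} [Fintype κ] [DecidableEq κ] {K : Type} [Fintype K] {g : B6.Geometry}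
  (blk : X → g.Site) (π : X' → X) (S : K → Set g.Site) (W : K → X → Matrix κ κ ℝ) (W' : K → X' → Matrix κ κ ℝ)
  (Δ : (X × κ → ℝ) →ₗ[ℝ] (X × κ → ℝ)) (Δ' : (X' × κ → ℝ) →ₗ[ℝ] (X' × κ → ℝ)) (hX χX : K → X → ℝ) (hX' χX' : K → X' → ℝ)
  (G' E' : K → (X × κ → ℝ) →ₗ[ℝ] (X × κ → ℝ)) (G'' E'' : K → (X' × κ → ℝ) →ₗ[ℝ] (X' × κ → ℝ))

/-! ## §1 The three η-defect row families transfer under two unrelated per-cube gauges with a displayed fit -/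

section Rows

omit [DecidableEq X] [DecidableEq X'] [Fintype K] in
/-- ★ **CUT DEFECTS TRANSFER WITH A GAUGE FIT**: local cut rows `β` on both grids, local cut defect `m`, gauge fit `o_W` ⟹ `𝔇(M_{χ′}G⁺, M_χG) ≤ 1_S1_S·(|κ|²m + 2|κ|o_Wβ)·e^{−δd}` for
`G = M_{Wᵀ}G′M_W`, `G⁺ = M_{W′ᵀ}G″M_{W′}`. [cite: Balaban1985BackgroundPropagators, (3.34)–(3.35) p.396, (3.42) p.397, Thm 3.14 pp.426–427 (shapes)] -/
theorem cutDefect_of_localGauges (hW : ∀ k x, W k x * (W k x)ᵀ = 1) (hV' : ∀ k x', (W' k x')ᵀ * W' k x' = 1)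
    {β m oW δ : ℝ} (hβ : 0 ≤ β) (hm : 0 ≤ m) (hoW : 0 ≤ oW) (k : K)
    (hfit : ∀ x' i, ∑ j, |(W' k x')ᵀ i j - (W k (π x'))ᵀ i j| ≤ oW) (hfit' : ∀ x' i, ∑ j, |W' k x' i j - W k (π x') i j| ≤ oW)
    (hGc : HasMaj (BlockNorm.ofBlocks g (liftBlk blk κ)) (BlockNorm.ofBlocks g (liftBlk blk κ)) (mulOp (fun p : X × κ => χX k p.1) ∘ₗ G' k)
      (fun y y' => ind (S k) y * ind (S k) y' * (β * Real.exp (-(δ * g.dist y y')))))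
    (hGc' : HasMaj (BlockNorm.ofBlocks g (liftBlk (blk ∘ π) κ)) (BlockNorm.ofBlocks g (liftBlk (blk ∘ π) κ)) (mulOp (fun p : X' × κ => χX' k p.1) ∘ₗ G'' k)
      (fun y y' => ind (S k) y * ind (S k) y' * (β * Real.exp (-(δ * g.dist y y')))))
    (hD : HasMaj (BlockNorm.ofBlocks g (liftBlk blk κ)) (BlockNorm.ofBlocks g (liftBlk (blk ∘ π) κ))
      (idef (pull (liftMap π κ)) (pull (liftMap π κ)) (mulOp (fun p : X' × κ => χX' k p.1) ∘ₗ G'' k) (mulOp (fun p : X × κ => χX k p.1) ∘ₗ G' k))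
      (fun y y' => ind (S k) y * ind (S k) y' * (m * Real.exp (-(δ * g.dist y y'))))) :
    HasMaj (BlockNorm.ofBlocks g (liftBlk blk κ)) (BlockNorm.ofBlocks g (liftBlk (blk ∘ π) κ))
      (idef (pull (liftMap π κ)) (pull (liftMap π κ))
        (mulOp (fun p : X' × κ => χX' k p.1) ∘ₗ (mmulOp (fun x' => (W' k x')ᵀ) ∘ₗ G'' k ∘ₗ mmulOp (W' k)))
        (mulOp (fun p : X × κ => χX k p.1) ∘ₗ (mmulOp (fun x => (W k x)ᵀ) ∘ₗ G' k ∘ₗ mmulOp (W k))))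
      (fun y y' => ind (S k) y * ind (S k) y' * (((Fintype.card κ : ℝ) ^ 2 * m + 2 * (Fintype.card κ : ℝ) * oW * β) * Real.exp (-(δ * g.dist y y')))) := by
  have e := mulOp_comp_gaugeConj (fun x => (W k x)ᵀ) (χX k) (G' k)
  have e' := mulOp_comp_gaugeConj (fun x' => (W' k x')ᵀ) (χX' k) (G'' k)
  simp only [Matrix.transpose_transpose] at e e'
  rw [show (fun x => W k x) = W k from rfl] at e
  rw [show (fun x' => W' k x') = W' k from rfl] at e'
  rw [e, e']
  have hK0 : ∀ y y', 0 ≤ ind (S k) y * ind (S k) y' * (β * Real.exp (-(δ * g.dist y y'))) := fun y y' =>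
    mul_nonneg (mul_nonneg (ind_nonneg _ y) (ind_nonneg _ y')) (mul_nonneg hβ (Real.exp_nonneg _))
  have h := hasMaj_idef_gaugeConj π (fun x => (W k x)ᵀ) (fun x' => (W' k x')ᵀ) blk (o := fun _ => oW) hK0 hK0
    (fun y y' => mul_nonneg (mul_nonneg (ind_nonneg _ y) (ind_nonneg _ y')) (mul_nonneg hm (Real.exp_nonneg _))) (fun _ => hoW)
    (fun x i j => by rw [Matrix.transpose_transpose]; exact entry_le_one_of_orthogonal (hW k) x i j) (transpose_entry_le_one_of_orthogonal (hV' k))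
    (fun x' i => hfit x' i) (fun x' i => by simpa only [Matrix.transpose_transpose] using hfit' x' i) hGc hGc' hD
  simp only [Matrix.transpose_transpose] at h
  rw [show (fun x => W k x) = W k from rfl, show (fun x' => W' k x') = W' k from rfl] at h
  exact h.mono fun y y' => le_of_eq (by ring)

omit [DecidableEq X] [DecidableEq X'] [Fintype K] in
/-- ★★ **COMMUTATOR DEFECTS TRANSFER WITH A GAUGE FIT**: local commutator rows `θ₀` (w.r.t. `Δ^W`, `Δ′^{W′}`) on both grids, local commutator defect `r`, gauge fit `o_W` ⟹
`𝔇([Δ′, M_{h′}]G⁺, [Δ, M_h]G) ≤ 1_S(y′)·(|κ|²r + 2|κ|o_Wθ₀)·e^{−δd}`. [cite: Balaban1984PropagatorsII, (2.93) p.239 (shape); Balaban1985BackgroundPropagators, (3.34) p.396, Thm 3.14 pp.426–427] -/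
theorem commDefect_of_localGauges (hW : ∀ k x, W k x * (W k x)ᵀ = 1) (hW' : ∀ k x, (W k x)ᵀ * W k x = 1) (hV : ∀ k x', W' k x' * (W' k x')ᵀ = 1) (hV' : ∀ k x', (W' k x')ᵀ * W' k x' = 1)
    {θ₀ r oW δ : ℝ} (hθ : 0 ≤ θ₀) (hr : 0 ≤ r) (hoW : 0 ≤ oW) (k : K)
    (hfit : ∀ x' i, ∑ j, |(W' k x')ᵀ i j - (W k (π x'))ᵀ i j| ≤ oW) (hfit' : ∀ x' i, ∑ j, |W' k x' i j - W k (π x') i j| ≤ oW)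
    (hK : HasMaj (BlockNorm.ofBlocks g (liftBlk blk κ)) (BlockNorm.ofBlocks g (liftBlk blk κ))
      (commOp (mmulOp (W k) ∘ₗ Δ ∘ₗ mmulOp (fun x => (W k x)ᵀ)) (fun p : X × κ => hX k p.1) ∘ₗ G' k) (fun y y' => ind (S k) y' * (θ₀ * Real.exp (-(δ * g.dist y y')))))
    (hK' : HasMaj (BlockNorm.ofBlocks g (liftBlk (blk ∘ π) κ)) (BlockNorm.ofBlocks g (liftBlk (blk ∘ π) κ))
      (commOp (mmulOp (W' k) ∘ₗ Δ' ∘ₗ mmulOp (fun x' => (W' k x')ᵀ)) (fun p : X' × κ => hX' k p.1) ∘ₗ G'' k) (fun y y' => ind (S k) y' * (θ₀ * Real.exp (-(δ * g.dist y y')))))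
    (hD : HasMaj (BlockNorm.ofBlocks g (liftBlk blk κ)) (BlockNorm.ofBlocks g (liftBlk (blk ∘ π) κ))
      (idef (pull (liftMap π κ)) (pull (liftMap π κ))
        (commOp (mmulOp (W' k) ∘ₗ Δ' ∘ₗ mmulOp (fun x' => (W' k x')ᵀ)) (fun p : X' × κ => hX' k p.1) ∘ₗ G'' k)
        (commOp (mmulOp (W k) ∘ₗ Δ ∘ₗ mmulOp (fun x => (W k x)ᵀ)) (fun p : X × κ => hX k p.1) ∘ₗ G' k))
      (fun y y' => ind (S k) y' * (r * Real.exp (-(δ * g.dist y y'))))) :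
    HasMaj (BlockNorm.ofBlocks g (liftBlk blk κ)) (BlockNorm.ofBlocks g (liftBlk (blk ∘ π) κ))
      (idef (pull (liftMap π κ)) (pull (liftMap π κ))
        (commOp Δ' (fun p : X' × κ => hX' k p.1) ∘ₗ (mmulOp (fun x' => (W' k x')ᵀ) ∘ₗ G'' k ∘ₗ mmulOp (W' k)))
        (commOp Δ (fun p : X × κ => hX k p.1) ∘ₗ (mmulOp (fun x => (W k x)ᵀ) ∘ₗ G' k ∘ₗ mmulOp (W k))))
      (fun y y' => ind (S k) y' * (((Fintype.card κ : ℝ) ^ 2 * r + 2 * (Fintype.card κ : ℝ) * oW * θ₀) * Real.exp (-(δ * g.dist y y')))) := by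
  have hU' : ∀ x, ((W k x)ᵀ)ᵀ * (W k x)ᵀ = 1 := fun x => by rw [Matrix.transpose_transpose]; exact hW k x
  have hU'' : ∀ x', ((W' k x')ᵀ)ᵀ * (W' k x')ᵀ = 1 := fun x' => by rw [Matrix.transpose_transpose]; exact hV k x'
  have e := commOp_comp_gaugeConj (fun x => (W k x)ᵀ) hU' (hX k) (mmulOp (W k) ∘ₗ Δ ∘ₗ mmulOp (fun x => (W k x)ᵀ)) (G' k)
  have e' := commOp_comp_gaugeConj (fun x' => (W' k x')ᵀ) hU'' (hX' k) (mmulOp (W' k) ∘ₗ Δ' ∘ₗ mmulOp (fun x' => (W' k x')ᵀ)) (G'' k)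
  simp only [Matrix.transpose_transpose] at e e'
  rw [show (fun x => W k x) = W k from rfl, localOp_conj_back W Δ hW' k] at e
  rw [show (fun x' => W' k x') = W' k from rfl, localOp_conj_back W' Δ' hV' k] at e'
  rw [e, e']
  have hK0 : ∀ y y', 0 ≤ ind (S k) y' * (θ₀ * Real.exp (-(δ * g.dist y y'))) := fun y y' => mul_nonneg (ind_nonneg _ y') (mul_nonneg hθ (Real.exp_nonneg _))
  have h := hasMaj_idef_gaugeConj π (fun x => (W k x)ᵀ) (fun x' => (W' k x')ᵀ) blk (o := fun _ => oW) hK0 hK0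
    (fun y y' => mul_nonneg (ind_nonneg _ y') (mul_nonneg hr (Real.exp_nonneg _))) (fun _ => hoW)
    (fun x i j => by rw [Matrix.transpose_transpose]; exact entry_le_one_of_orthogonal (hW k) x i j) (transpose_entry_le_one_of_orthogonal (hV' k))
    (fun x' i => hfit x' i) (fun x' i => by simpa only [Matrix.transpose_transpose] using hfit' x' i) hK hK' hD
  simp only [Matrix.transpose_transpose] at h
  rw [show (fun x => W k x) = W k from rfl, show (fun x' => W' k x') = W' k from rfl] at h
  exact h.mono fun y y' => le_of_eq (by ring)

omit [DecidableEq X] [DecidableEq X'] [Fintype K] in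
/-- ★ **DEFECT-ROW DEFECTS TRANSFER WITH A GAUGE FIT**: local defect rows `ε` on both grids, their defect `r_E`, gauge fit `o_W` ⟹ `𝔇(E⁺, E) ≤ 1_S(y)·(|κ|²r_E + 2|κ|o_Wε)·e^{−δd}`.
[cite: Balaban1985BackgroundPropagators, (3.34)–(3.35) p.396, Thm 3.14 pp.426–427 (shapes)] -/
theorem defectDefect_of_localGauges (hW : ∀ k x, W k x * (W k x)ᵀ = 1) (hV' : ∀ k x', (W' k x')ᵀ * W' k x' = 1) {ε rE oW δ : ℝ} (hε : 0 ≤ ε) (hrE : 0 ≤ rE) (hoW : 0 ≤ oW) (k : K)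
    (hfit : ∀ x' i, ∑ j, |(W' k x')ᵀ i j - (W k (π x'))ᵀ i j| ≤ oW) (hfit' : ∀ x' i, ∑ j, |W' k x' i j - W k (π x') i j| ≤ oW)
    (hE : HasMaj (BlockNorm.ofBlocks g (liftBlk blk κ)) (BlockNorm.ofBlocks g (liftBlk blk κ)) (E' k) (fun y y' => ind (S k) y * (ε * Real.exp (-(δ * g.dist y y')))))
    (hE' : HasMaj (BlockNorm.ofBlocks g (liftBlk (blk ∘ π) κ)) (BlockNorm.ofBlocks g (liftBlk (blk ∘ π) κ)) (E'' k) (fun y y' => ind (S k) y * (ε * Real.exp (-(δ * g.dist y y')))))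
    (hD : HasMaj (BlockNorm.ofBlocks g (liftBlk blk κ)) (BlockNorm.ofBlocks g (liftBlk (blk ∘ π) κ)) (idef (pull (liftMap π κ)) (pull (liftMap π κ)) (E'' k) (E' k))
      (fun y y' => ind (S k) y * (rE * Real.exp (-(δ * g.dist y y'))))) :
    HasMaj (BlockNorm.ofBlocks g (liftBlk blk κ)) (BlockNorm.ofBlocks g (liftBlk (blk ∘ π) κ))
      (idef (pull (liftMap π κ)) (pull (liftMap π κ)) (mmulOp (fun x' => (W' k x')ᵀ) ∘ₗ E'' k ∘ₗ mmulOp (W' k)) (mmulOp (fun x => (W k x)ᵀ) ∘ₗ E' k ∘ₗ mmulOp (W k)))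
      (fun y y' => ind (S k) y * (((Fintype.card κ : ℝ) ^ 2 * rE + 2 * (Fintype.card κ : ℝ) * oW * ε) * Real.exp (-(δ * g.dist y y')))) := by
  have hK0 : ∀ y y', 0 ≤ ind (S k) y * (ε * Real.exp (-(δ * g.dist y y'))) := fun y y' => mul_nonneg (ind_nonneg _ y) (mul_nonneg hε (Real.exp_nonneg _))
  have h := hasMaj_idef_gaugeConj π (fun x => (W k x)ᵀ) (fun x' => (W' k x')ᵀ) blk (o := fun _ => oW) hK0 hK0
    (fun y y' => mul_nonneg (ind_nonneg _ y) (mul_nonneg hrE (Real.exp_nonneg _))) (fun _ => hoW)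
    (fun x i j => by rw [Matrix.transpose_transpose]; exact entry_le_one_of_orthogonal (hW k) x i j) (transpose_entry_le_one_of_orthogonal (hV' k))
    (fun x' i => hfit x' i) (fun x' i => by simpa only [Matrix.transpose_transpose] using hfit' x' i) hE hE' hD
  simp only [Matrix.transpose_transpose] at h
  rw [show (fun x => W k x) = W k from rfl, show (fun x' => W' k x') = W' k from rfl] at h
  exact h.mono fun y y' => le_of_eq (by ring)

end Rows

/-! ## §2 File 32's two-grid gluing with unrelated per-cube gauges -/

section Glue

variable {σ cr : ℝ}

/-- ★★★ **THE η-DEFECT OF THE GLUED OPERATOR WITH UNRELATED FINE ∕ COARSE PER-CUBE GAUGES**: file 32 `hasMaj_idef_glued_of_cutRows_defect` for `G_k = M_{W_kᵀ}G′_kM_{W_k}`,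
`G⁺_k = M_{W′_kᵀ}G″_kM_{W′_k}` (likewise `E_k, E⁺_k`) from rows ∕ defects given in the cubes' gauges and the gauges' max-row-sum fit `o_W` along `π`; constants
`(β, θ₀, ε) ↦ |κ|²(β, θ₀, ε)`, `(m, r, r_E) ↦ (|κ|²m + 2|κ|o_Wβ, |κ|²r + 2|κ|o_Wθ₀, |κ|²r_E + 2|κ|o_Wε)`.
[cite: Balaban1985BackgroundPropagators, (3.34)–(3.35) p.396, (3.87) p.409, Thm 3.14 pp.426–427 (shapes ∕ template); Balaban1984PropagatorsII, (2.91) p.239, (2.133)–(2.136) p.247] -/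
theorem hasMaj_idef_glued_of_localGauges_fit (htri : Triangle254 g) (hd : ∀ a b : g.Site, 0 ≤ g.dist a b) (hd0 : ∀ y : g.Site, g.dist y y = 0) (hrow : RowSum g σ cr) (hσ : 0 ≤ σ)
    (hcr : 0 ≤ cr) (hW : ∀ k x, W k x * (W k x)ᵀ = 1) (hW' : ∀ k x, (W k x)ᵀ * W k x = 1) (hV : ∀ k x', W' k x' * (W' k x')ᵀ = 1) (hV' : ∀ k x', (W' k x')ᵀ * W' k x' = 1)
    {β θ₀ ε m r rE o oW δ Nov : ℝ} (hβ : 0 ≤ β) (hθ : 0 ≤ θ₀) (hε : 0 ≤ ε) (hm : 0 ≤ m) (hr : 0 ≤ r) (hrE : 0 ≤ rE) (ho : 0 ≤ o) (hoW : 0 ≤ oW) (hNov : 0 ≤ Nov) (hσδ : 2 * σ ≤ δ)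
    (hfitW : ∀ k x' i, ∑ j, |(W' k x')ᵀ i j - (W k (π x'))ᵀ i j| ≤ oW) (hfitW' : ∀ k x' i, ∑ j, |W' k x' i j - W k (π x') i j| ≤ oW)
    (hcut : ∀ k, mulOp (fun p : X × κ => hX k p.1) ∘ₗ mulOp (fun p : X × κ => χX k p.1) = mulOp (fun p : X × κ => hX k p.1))
    (hcut' : ∀ k, mulOp (fun p : X' × κ => hX' k p.1) ∘ₗ mulOp (fun p : X' × κ => χX' k p.1) = mulOp (fun p : X' × κ => hX' k p.1))
    (hh : ∀ k p, |(fun p : X × κ => hX k p.1) p| ≤ 1) (hh' : ∀ k p, |(fun p : X' × κ => hX' k p.1) p| ≤ 1)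
    (hfit : ∀ k p, |(fun p : X' × κ => hX' k p.1) p - (fun p : X × κ => hX k p.1) (liftMap π κ p)| ≤ o) (hN : ∀ a, ∑ k, ind (S k) a ≤ Nov)
    (hGc : ∀ k, HasMaj (BlockNorm.ofBlocks g (liftBlk blk κ)) (BlockNorm.ofBlocks g (liftBlk blk κ)) (mulOp (fun p : X × κ => χX k p.1) ∘ₗ G' k)
      (fun y y' => ind (S k) y * ind (S k) y' * (β * Real.exp (-(δ * g.dist y y')))))
    (hGc' : ∀ k, HasMaj (BlockNorm.ofBlocks g (liftBlk (blk ∘ π) κ)) (BlockNorm.ofBlocks g (liftBlk (blk ∘ π) κ)) (mulOp (fun p : X' × κ => χX' k p.1) ∘ₗ G'' k)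
      (fun y y' => ind (S k) y * ind (S k) y' * (β * Real.exp (-(δ * g.dist y y')))))
    (hK : ∀ k, HasMaj (BlockNorm.ofBlocks g (liftBlk blk κ)) (BlockNorm.ofBlocks g (liftBlk blk κ))
      (commOp (mmulOp (W k) ∘ₗ Δ ∘ₗ mmulOp (fun x => (W k x)ᵀ)) (fun p : X × κ => hX k p.1) ∘ₗ G' k) (fun y y' => ind (S k) y' * (θ₀ * Real.exp (-(δ * g.dist y y')))))
    (hK' : ∀ k, HasMaj (BlockNorm.ofBlocks g (liftBlk (blk ∘ π) κ)) (BlockNorm.ofBlocks g (liftBlk (blk ∘ π) κ))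
      (commOp (mmulOp (W' k) ∘ₗ Δ' ∘ₗ mmulOp (fun x' => (W' k x')ᵀ)) (fun p : X' × κ => hX' k p.1) ∘ₗ G'' k) (fun y y' => ind (S k) y' * (θ₀ * Real.exp (-(δ * g.dist y y')))))
    (hE : ∀ k, HasMaj (BlockNorm.ofBlocks g (liftBlk blk κ)) (BlockNorm.ofBlocks g (liftBlk blk κ)) (E' k) (fun y y' => ind (S k) y * (ε * Real.exp (-(δ * g.dist y y')))))
    (hE' : ∀ k, HasMaj (BlockNorm.ofBlocks g (liftBlk (blk ∘ π) κ)) (BlockNorm.ofBlocks g (liftBlk (blk ∘ π) κ)) (E'' k) (fun y y' => ind (S k) y * (ε * Real.exp (-(δ * g.dist y y')))))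
    (hDGc : ∀ k, HasMaj (BlockNorm.ofBlocks g (liftBlk blk κ)) (BlockNorm.ofBlocks g (liftBlk (blk ∘ π) κ))
      (idef (pull (liftMap π κ)) (pull (liftMap π κ)) (mulOp (fun p : X' × κ => χX' k p.1) ∘ₗ G'' k) (mulOp (fun p : X × κ => χX k p.1) ∘ₗ G' k))
      (fun y y' => ind (S k) y * ind (S k) y' * (m * Real.exp (-(δ * g.dist y y')))))
    (hDK : ∀ k, HasMaj (BlockNorm.ofBlocks g (liftBlk blk κ)) (BlockNorm.ofBlocks g (liftBlk (blk ∘ π) κ))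
      (idef (pull (liftMap π κ)) (pull (liftMap π κ))
        (commOp (mmulOp (W' k) ∘ₗ Δ' ∘ₗ mmulOp (fun x' => (W' k x')ᵀ)) (fun p : X' × κ => hX' k p.1) ∘ₗ G'' k)
        (commOp (mmulOp (W k) ∘ₗ Δ ∘ₗ mmulOp (fun x => (W k x)ᵀ)) (fun p : X × κ => hX k p.1) ∘ₗ G' k))
      (fun y y' => ind (S k) y' * (r * Real.exp (-(δ * g.dist y y')))))
    (hDE : ∀ k, HasMaj (BlockNorm.ofBlocks g (liftBlk blk κ)) (BlockNorm.ofBlocks g (liftBlk (blk ∘ π) κ)) (idef (pull (liftMap π κ)) (pull (liftMap π κ)) (E'' k) (E' k))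
      (fun y y' => ind (S k) y * (rE * Real.exp (-(δ * g.dist y y')))))
    (hq : Nov * ((Fintype.card κ : ℝ) ^ 2 * θ₀ + (Fintype.card κ : ℝ) ^ 2 * ε) * cr < 1) :
    HasMaj (BlockNorm.ofBlocks g (liftBlk blk κ)) (BlockNorm.ofBlocks g (liftBlk (blk ∘ π) κ))
      (idef (pull (liftMap π κ)) (pull (liftMap π κ))
        (glueInv (parametrix (fun k => fun p : X' × κ => hX' k p.1) (fun k => mmulOp (fun x' => (W' k x')ᵀ) ∘ₗ G'' k ∘ₗ mmulOp (W' k)))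
          (remainder Δ' (fun k => fun p : X' × κ => hX' k p.1) (fun k => mmulOp (fun x' => (W' k x')ᵀ) ∘ₗ G'' k ∘ₗ mmulOp (W' k)) -
            ∑ k, (mmulOp (fun x' => (W' k x')ᵀ) ∘ₗ E'' k ∘ₗ mmulOp (W' k)) ∘ₗ mulOp (fun p : X' × κ => hX' k p.1)))
        (glueInv (parametrix (fun k => fun p : X × κ => hX k p.1) (fun k => mmulOp (fun x => (W k x)ᵀ) ∘ₗ G' k ∘ₗ mmulOp (W k)))
          (remainder Δ (fun k => fun p : X × κ => hX k p.1) (fun k => mmulOp (fun x => (W k x)ᵀ) ∘ₗ G' k ∘ₗ mmulOp (W k)) -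
            ∑ k, (mmulOp (fun x => (W k x)ᵀ) ∘ₗ E' k ∘ₗ mmulOp (W k)) ∘ₗ mulOp (fun p : X × κ => hX k p.1))))
      (fun y y' => (Nov * ((Fintype.card κ : ℝ) ^ 2 * β) * ((1 - Nov * ((Fintype.card κ : ℝ) ^ 2 * θ₀ + (Fintype.card κ : ℝ) ^ 2 * ε) * cr)⁻¹ *
          ((1 - Nov * ((Fintype.card κ : ℝ) ^ 2 * θ₀ + (Fintype.card κ : ℝ) ^ 2 * ε) * cr)⁻¹ *
            (Nov * ((Fintype.card κ : ℝ) ^ 2 * θ₀ * o + ((Fintype.card κ : ℝ) ^ 2 * r + 2 * (Fintype.card κ : ℝ) * oW * θ₀) +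
              ((Fintype.card κ : ℝ) ^ 2 * ε * o + ((Fintype.card κ : ℝ) ^ 2 * rE + 2 * (Fintype.card κ : ℝ) * oW * ε)))) * cr) * cr) * cr +
        Nov * (2 * ((Fintype.card κ : ℝ) ^ 2 * β) * o + ((Fintype.card κ : ℝ) ^ 2 * m + 2 * (Fintype.card κ : ℝ) * oW * β)) *
          (1 - Nov * ((Fintype.card κ : ℝ) ^ 2 * θ₀ + (Fintype.card κ : ℝ) ^ 2 * ε) * cr)⁻¹ * cr) *
        Real.exp (-((δ - 2 * σ) * g.dist y y'))) :=
  hasMaj_idef_glued_of_cutRows_defect (liftBlk blk κ) (liftMap π κ) S htri hd hd0 hrow hσ hcr (by positivity) (by positivity) (by positivity) (by positivity) (by positivity)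
    (by positivity) ho hNov hσδ hcut hcut' hh hh' hfit hN
    (fun k => cutRow_of_localGauge blk S W χX G' hW hW' hβ k (hGc k)) (fun k => cutRow_of_localGauge (blk ∘ π) S W' χX' G'' hV hV' hβ k (hGc' k))
    (fun k => commRow_of_localGauge blk S W Δ hX G' hW hW' hθ k (hK k)) (fun k => commRow_of_localGauge (blk ∘ π) S W' Δ' hX' G'' hV hV' hθ k (hK' k))
    (fun k => defectRow_of_localGauge blk S W E' hW hW' hε k (hE k)) (fun k => defectRow_of_localGauge (blk ∘ π) S W' E'' hV hV' hε k (hE' k))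
    (fun k => cutDefect_of_localGauges blk π S W W' χX χX' G' G'' hW hV' hβ hm hoW k (hfitW k) (hfitW' k) (hGc k) (hGc' k) (hDGc k))
    (fun k => commDefect_of_localGauges blk π S W W' Δ Δ' hX hX' G' G'' hW hW' hV hV' hθ hr hoW k (hfitW k) (hfitW' k) (hK k) (hK' k) (hDK k))
    (fun k => defectDefect_of_localGauges blk π S W W' E' E'' hW hV' hε hrE hoW k (hfitW k) (hfitW' k) (hE k) (hE' k) (hDE k)) hq

end Glue

end Summit.QuantumFields.YangMills.BalabanUVNodes.N15.CurvedSpecies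

end
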